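import Summits.QuantumFields.YangMills.Theorems.ToronValleyVolumeNearlyCommutingCeilingSection
import HarnessLib

/-!
# Cone-measure sections for ANTICOMMUTING letters: `‖xy + yx‖² = 4((re y)²‖x‖² + (re x)²‖Im y‖² + ⟨Im x, Im y⟩²)`, rotated slabs, and
# `cone{w : ‖yw + wy‖ ≤ s} ≤ c·4s²/‖y‖²`, `cone{w : ‖yw − wy‖ ≤ s} ≤ c·4s²/‖Im y‖²`, `cone{|re y| ≤ δ} ≤ c·16δ`
# (free-hands support of item stmt-QuantumFields-24197 `SwapVirialDeficit.SwapGluedStiffness`; brick (B-iii) of seat w2 g54's fixed-`L` swap-ceiling plan,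
# cell ym-idea-1 STATUS 06:57Z: the seam sectors `ε_c = −1` of `Z^S` — the `t`-letter ANTICOMMUTES with the `c`-letter up to `t`)

The four-letter event of the seam sectors `(ε_a, ε_b, ε_c) = (ε, ε, −1)` of the swap-glued femto ring asks `‖q_t q_c + q_c q_t‖ ≤ t`: near-anticommutation
of two unit quaternions, whose exact locus `{re q_t = re q_c = 0, Im q_t ⊥ Im q_c}` has codimension `3` in `SU(2)²`.  This file supplies the cone-measure
sections for its volume bound `≍ t³` (sequel: `SwapVirialDeficitSigmaTwistedMinusSectorCeiling`), in the style of ✓`ToronValleyVolumeNearlyCommutingCeilingSection`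
(fcl-p3 g43), whose straightening unit ✓`exists_unit_straighten` and conjugation isometry ✓`conjIso` are reused BY NAME:

* §1 algebra: `anticomm_conj_of_norm_eq_one` (`ū(yw + wy)u = y′w′ + w′y′`), `norm_anticomm_sq` (the identity in the title — no unit assumption),
  `four_mul_re_sq_le_norm_anticomm_sq` (`4(re y)²‖x‖² ≤ ‖xy + yx‖²`), `norm_anticomm_sq_axisPoint` ∕ `_star_axisPoint`
  (`‖y′w + wy′‖² = 4((re y)² + ‖Im y‖²)((re w)² + (w_I)²) + 4(re y)²((w_J)² + (w_K)²)` for the straightened letter `y′ = re y ± ‖Im y‖·i`);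
* §2 ★ `anti_section_subset_preimage_box`, ★ `coneMeasure_anti_section_le` — `cone{w : ‖yw + wy‖ ≤ s} ≤ coneConst·4s²/‖y‖²` (`Im y ≠ 0`): after
  straightening, `|re w′|, |w′_I| ≤ s/(2‖y‖)`, a rotated slab `[-s/2‖y‖, s/2‖y‖]² × [-1,1]²`;
* §3 ★ `comm_section_subset_preimage_box'`, ★ `coneMeasure_comm_section_le'` — the commutator section WITHOUT the argmax constraint `‖Im w‖ ≤ ‖Im y‖`:
  `cone{w : ‖yw − wy‖ ≤ s} ≤ coneConst·4s²/‖Im y‖²`;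
* §4 `reSlab_inter_ball_subset`, ★ `coneMeasure_reSlab_le` — `cone{y : |re y| ≤ δ} ≤ coneConst·16δ`.

HONEST LABEL: finite-dimensional Lebesgue∕cone-measure bookkeeping toward a fixed-`L` prediction row; nothing about ⟨24197⟩ ∕ ⟨24194⟩ ∕ ⟨24497⟩ ∕ ⟨24196⟩ or any rung
is proved; the Yang–Mills mass gap is NOT proved; no summit is proved by a line.  THEOREMS ONLY (0 `def`, 0 `sorry`), standard axioms.  Width seat
ym-line-sfw-p2-w2 g54 (cell ym-idea-1, free hands), `--supports stmt-QuantumFields-24197`.  References: [cite: tHooft1979]; [cite: GonzalezarroyoAltes1988]; [folklore].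
-/

set_option autoImplicit false

noncomputable section

open MeasureTheory Quaternion Set
open scoped Quaternion ENNReal BigOperators
open Literature.MathematicalPhysics.QuantumLattice
open Summit.QuantumFields.YangMills.Theorems.SwapTwistDeficit.ToronLog
open Summit.QuantumFields.YangMills.Theorems.ToronValleyVolume.NearlyCommutingCeiling

attribute [local instance] Literature.Analysis.FluidPDE.Tao2016.quatMeasurableSpace
  Literature.Analysis.FluidPDE.Tao2016.quatBorelSpace

namespace Summit.QuantumFields.YangMills.Theorems.SwapVirialDeficit.AnticommutingSections

/-! ## §1 Algebra of the anticommutator -/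

/-- Conjugation by a unit quaternion transports anticommutators: `(ū y u)(ū w u) + (ū w u)(ū y u) = ū (yw + wy) u`. [folklore] -/
theorem anticomm_conj_of_norm_eq_one {u : ℍ} (hu : ‖u‖ = 1) (y w : ℍ) :
    (star u * y * u) * (star u * w * u) + (star u * w * u) * (star u * y * u) = star u * (y * w + w * y) * u := by
  have hus : u * star u = 1 := by
    rw [Quaternion.self_mul_star, Quaternion.normSq_eq_norm_mul_self, hu, mul_one, Quaternion.coe_one]
  have h1 : ∀ a b : ℍ, (star u * a * u) * (star u * b * u) = star u * (a * b) * u := by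
    intro a b
    calc (star u * a * u) * (star u * b * u) = star u * a * (u * star u) * b * u := by simp only [mul_assoc]
      _ = star u * (a * b) * u := by rw [hus]; simp only [mul_one, mul_assoc]
  rw [h1, h1, mul_add, add_mul]

/-- **The anticommutator identity**: `‖xy + yx‖² = 4((re y)²‖x‖² + (re x)²‖Im y‖² + ⟨Im x, Im y⟩²)` (no normalisation needed). [folklore] -/
theorem norm_anticomm_sq (x y : ℍ) :
    ‖x * y + y * x‖ ^ 2 = 4 * (y.re ^ 2 * ‖x‖ ^ 2 + x.re ^ 2 * (y.imI ^ 2 + y.imJ ^ 2 + y.imK ^ 2) +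
      (x.imI * y.imI + x.imJ * y.imJ + x.imK * y.imK) ^ 2) := by
  have h : ‖x * y + y * x‖ ^ 2 = (x * y + y * x).re ^ 2 + (x * y + y * x).imI ^ 2 + (x * y + y * x).imJ ^ 2 +
      (x * y + y * x).imK ^ 2 := by
    rw [sq, ← Quaternion.normSq_eq_norm_mul_self, Quaternion.normSq_def']
  rw [h, sq_norm_eq_sum_sq x]
  simp only [Quaternion.re_add, Quaternion.imI_add, Quaternion.imJ_add, Quaternion.imK_add,
    Quaternion.re_mul, Quaternion.imI_mul, Quaternion.imJ_mul, Quaternion.imK_mul]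
  ring

/-- `4(re y)²‖x‖² ≤ ‖xy + yx‖²`: an almost anticommuting partner of `x ≠ 0` is almost traceless. [folklore] -/
theorem four_mul_re_sq_le_norm_anticomm_sq (x y : ℍ) : 4 * y.re ^ 2 * ‖x‖ ^ 2 ≤ ‖x * y + y * x‖ ^ 2 := by
  rw [norm_anticomm_sq]
  nlinarith [sq_nonneg x.re, sq_nonneg y.imI, sq_nonneg y.imJ, sq_nonneg y.imK,
    sq_nonneg (x.imI * y.imI + x.imJ * y.imJ + x.imK * y.imK), mul_nonneg (sq_nonneg x.re) (add_nonneg (add_nonneg (sq_nonneg y.imI) (sq_nonneg y.imJ)) (sq_nonneg y.imK))]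

/-- A straightened letter: `‖y′w + wy′‖² = 4(((re y)² + ‖Im y‖²)((re w)² + (w_I)²) + (re y)²((w_J)² + (w_K)²))` for `y′ = re y + ‖Im y‖·i`. [folklore] -/
theorem norm_anticomm_sq_axisPoint (y w : ℍ) :
    ‖axisPoint y * w + w * axisPoint y‖ ^ 2 =
      4 * ((y.re ^ 2 + ‖y.im‖ ^ 2) * (w.re ^ 2 + w.imI ^ 2) + y.re ^ 2 * (w.imJ ^ 2 + w.imK ^ 2)) := by
  have h : ‖axisPoint y * w + w * axisPoint y‖ ^ 2 = (axisPoint y * w + w * axisPoint y).re ^ 2 +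
      (axisPoint y * w + w * axisPoint y).imI ^ 2 + (axisPoint y * w + w * axisPoint y).imJ ^ 2 +
        (axisPoint y * w + w * axisPoint y).imK ^ 2 := by
    rw [sq, ← Quaternion.normSq_eq_norm_mul_self, Quaternion.normSq_def']
  rw [h]
  simp [axisPoint]
  ring

/-- The same for the conjugate straightened letter `re y − ‖Im y‖·i`. [folklore] -/
theorem norm_anticomm_sq_star_axisPoint (y w : ℍ) :
    ‖star (axisPoint y) * w + w * star (axisPoint y)‖ ^ 2 =
      4 * ((y.re ^ 2 + ‖y.im‖ ^ 2) * (w.re ^ 2 + w.imI ^ 2) + y.re ^ 2 * (w.imJ ^ 2 + w.imK ^ 2)) := by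
  have h : ‖star (axisPoint y) * w + w * star (axisPoint y)‖ ^ 2 = (star (axisPoint y) * w + w * star (axisPoint y)).re ^ 2 +
      (star (axisPoint y) * w + w * star (axisPoint y)).imI ^ 2 + (star (axisPoint y) * w + w * star (axisPoint y)).imJ ^ 2 +
        (star (axisPoint y) * w + w * star (axisPoint y)).imK ^ 2 := by
    rw [sq, ← Quaternion.normSq_eq_norm_mul_self, Quaternion.normSq_def']
  rw [h]
  simp [axisPoint]
  ring

/-- `(re y)² + ‖Im y‖² = ‖y‖²`. [folklore] -/
theorem re_sq_add_norm_im_sq (y : ℍ) : y.re ^ 2 + ‖y.im‖ ^ 2 = ‖y‖ ^ 2 := by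
  rw [sq_norm_im_eq]; ring

/-! ## §2 The anticommutator section is a rotated slab of area `≍ (s/‖y‖)²` -/

/-- ★ **Anticommutator section ⊆ rotated slab.**  If `Im y ≠ 0`, `u` straightens `y`, `‖w‖ < 1` and `‖yw + wy‖ ≤ s` (`s ≥ 0`), then `ū w u` lies in the box
`[-s/(2‖y‖), s/(2‖y‖)]² × [-1,1]²` (coordinates `re, I, J, K`). [folklore] -/
theorem anti_section_subset_preimage_box {y u : ℍ} {s : ℝ} (hs : 0 ≤ s) (hy : y.im ≠ 0) (hu : ‖u‖ = 1)
    (hstr : star u * y * u = axisPoint y ∨ star u * y * u = star (axisPoint y)) :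
    {w : ℍ | ‖y * w + w * y‖ ≤ s} ∩ Metric.ball 0 1 ⊆
      (conjIso u hu) ⁻¹' quatBox ![-(s / (2 * ‖y‖)), -(s / (2 * ‖y‖)), -1, -1] ![s / (2 * ‖y‖), s / (2 * ‖y‖), 1, 1] := by
  have hm : 0 < ‖y.im‖ := norm_pos_iff.2 hy
  have hy0 : 0 < ‖y‖ := by
    have := re_sq_add_norm_im_sq y
    nlinarith [norm_nonneg y, sq_nonneg y.re]
  intro w hw
  simp only [Set.mem_inter_iff, Set.mem_setOf_eq, Metric.mem_ball, dist_zero_right] at hw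
  obtain ⟨hanti, hball⟩ := hw
  simp only [Set.mem_preimage, conjIso_apply, quatBox, Set.mem_setOf_eq, Matrix.cons_val_zero, Matrix.cons_val_one,
    Matrix.cons_val]
  set w' : ℍ := star u * w * u with hw'
  -- the transverse coordinates are bounded by `‖w′‖ = ‖w‖ < 1`
  have hn : ‖w'‖ < 1 := by rw [hw', norm_conj_of_norm_eq_one hu]; exact hball
  have hsq := sq_norm_eq_sum_sq w'
  have hJ : |w'.imJ| ≤ 1 := abs_le_of_sq_le_sq' (by nlinarith [sq_nonneg w'.re, sq_nonneg w'.imI, sq_nonneg w'.imK, norm_nonneg w']) zero_le_one |>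
    fun h => abs_le.2 h
  have hK : |w'.imK| ≤ 1 := abs_le_of_sq_le_sq' (by nlinarith [sq_nonneg w'.re, sq_nonneg w'.imI, sq_nonneg w'.imJ, norm_nonneg w']) zero_le_one |>
    fun h => abs_le.2 h
  -- the anticommutator after straightening
  have hc : ‖(star u * y * u) * w' + w' * (star u * y * u)‖ ≤ s := by
    rw [hw', anticomm_conj_of_norm_eq_one hu, norm_conj_of_norm_eq_one hu]
    exact hanti
  have hsq2 : 4 * (‖y‖ ^ 2 * (w'.re ^ 2 + w'.imI ^ 2)) ≤ s ^ 2 := by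
    have key : 4 * ((y.re ^ 2 + ‖y.im‖ ^ 2) * (w'.re ^ 2 + w'.imI ^ 2) + y.re ^ 2 * (w'.imJ ^ 2 + w'.imK ^ 2)) ≤ s ^ 2 := by
      rcases hstr with h | h
      · rw [← norm_anticomm_sq_axisPoint, ← h]
        exact pow_le_pow_left₀ (norm_nonneg _) hc 2
      · rw [← norm_anticomm_sq_star_axisPoint, ← h]
        exact pow_le_pow_left₀ (norm_nonneg _) hc 2
    rw [re_sq_add_norm_im_sq] at key
    nlinarith [sq_nonneg y.re, sq_nonneg w'.imJ, sq_nonneg w'.imK,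
      mul_nonneg (sq_nonneg y.re) (add_nonneg (sq_nonneg w'.imJ) (sq_nonneg w'.imK))]
  have hb : (s / (2 * ‖y‖)) ^ 2 = s ^ 2 / (4 * ‖y‖ ^ 2) := by rw [div_pow]; ring
  have h4 : 0 < 4 * ‖y‖ ^ 2 := by positivity
  have hre2 : w'.re ^ 2 ≤ (s / (2 * ‖y‖)) ^ 2 := by
    rw [hb, le_div_iff₀ h4]; nlinarith [sq_nonneg w'.imI, norm_nonneg y]
  have hI2 : w'.imI ^ 2 ≤ (s / (2 * ‖y‖)) ^ 2 := by
    rw [hb, le_div_iff₀ h4]; nlinarith [sq_nonneg w'.re, norm_nonneg y]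
  have hr0 : 0 ≤ s / (2 * ‖y‖) := by positivity
  have hre := abs_le.1 (abs_le_of_sq_le_sq' hre2 hr0 |> fun h => abs_le.2 h)
  have hI := abs_le.1 (abs_le_of_sq_le_sq' hI2 hr0 |> fun h => abs_le.2 h)
  obtain ⟨hJ1, hJ2⟩ := abs_le.1 hJ
  obtain ⟨hK1, hK2⟩ := abs_le.1 hK
  exact ⟨hre.1, hre.2, hI.1, hI.2, hJ1, hJ2, hK1, hK2⟩

/-- The anticommutator section is measurable (closed). [folklore] -/
theorem measurableSet_anti_section (y : ℍ) (s : ℝ) : MeasurableSet {w : ℍ | ‖y * w + w * y‖ ≤ s} :=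
  measurableSet_le (((continuous_const.mul continuous_id).add (continuous_id.mul continuous_const)).norm).measurable measurable_const

/-- Volume of the anticommutator section inside the unit ball: `≤ 4s²/‖y‖²`. [folklore] -/
theorem volume_anti_section_le {y : ℍ} {s : ℝ} (hs : 0 ≤ s) (hy : y.im ≠ 0) :
    volume ({w : ℍ | ‖y * w + w * y‖ ≤ s} ∩ Metric.ball 0 1) ≤ ENNReal.ofReal (4 * s ^ 2 / ‖y‖ ^ 2) := by
  have hy0 : 0 < ‖y‖ := by
    have hm : 0 < ‖y.im‖ := norm_pos_iff.2 hy
    have := re_sq_add_norm_im_sq y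
    nlinarith [norm_nonneg y, sq_nonneg y.re]
  obtain ⟨u, hu, hstr⟩ := exists_unit_straighten hy
  refine (measure_mono (anti_section_subset_preimage_box hs hy hu hstr)).trans ?_
  rw [(conjIso u hu).measurePreserving.measure_preimage (measurableSet_quatBox _ _).nullMeasurableSet, volume_quatBox]
  · apply le_of_eq
    congr 1
    simp only [Matrix.cons_val_zero, Matrix.cons_val_one, Matrix.cons_val]
    field_simp
    ring
  · intro i
    have : 0 ≤ s / (2 * ‖y‖) := by positivity
    fin_cases i <;> simp <;> linarith

/-- ★ **Cone mass of the anticommutator section**: `cone{w : ‖yw + wy‖ ≤ s} ≤ coneConst·4s²/‖y‖²` for `Im y ≠ 0`. [folklore] -/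
theorem coneMeasure_anti_section_le {y : ℍ} {s : ℝ} (hs : 0 ≤ s) (hy : y.im ≠ 0) :
    coneMeasure {w : ℍ | ‖y * w + w * y‖ ≤ s} ≤ ENNReal.ofReal (coneConst * (4 * s ^ 2 / ‖y‖ ^ 2)) := by
  rw [coneMeasure_eq _ (measurableSet_anti_section y s), ENNReal.ofReal_mul coneConst_pos.le, ← inv_volume_ball_eq]
  exact mul_le_mul_right (volume_anti_section_le hs hy) _

/-! ## §3 The commutator section without the argmax constraint -/

/-- ★ **Commutator section ⊆ rotated slab** (no constraint on `‖Im w‖`): `Im y ≠ 0`, `u` straightens `y`, `‖w‖ < 1`, `‖yw − wy‖ ≤ s` ⟹ `ū w u` lies in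
`[-1,1]² × [-s/(2‖Im y‖), s/(2‖Im y‖)]²`. [folklore] -/
theorem comm_section_subset_preimage_box' {y u : ℍ} {s : ℝ} (hs : 0 ≤ s) (hy : y.im ≠ 0) (hu : ‖u‖ = 1)
    (hstr : star u * y * u = axisPoint y ∨ star u * y * u = star (axisPoint y)) :
    {w : ℍ | ‖y * w - w * y‖ ≤ s} ∩ Metric.ball 0 1 ⊆
      (conjIso u hu) ⁻¹' quatBox ![-1, -1, -(s / (2 * ‖y.im‖)), -(s / (2 * ‖y.im‖))] ![1, 1, s / (2 * ‖y.im‖), s / (2 * ‖y.im‖)] := by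
  have hm : 0 < ‖y.im‖ := norm_pos_iff.2 hy
  intro w hw
  simp only [Set.mem_inter_iff, Set.mem_setOf_eq, Metric.mem_ball, dist_zero_right] at hw
  obtain ⟨hcomm, hball⟩ := hw
  simp only [Set.mem_preimage, conjIso_apply, quatBox, Set.mem_setOf_eq, Matrix.cons_val_zero, Matrix.cons_val_one,
    Matrix.cons_val]
  set w' : ℍ := star u * w * u with hw'
  have hn : ‖w'‖ < 1 := by rw [hw', norm_conj_of_norm_eq_one hu]; exact hball
  have hre : |w'.re| ≤ 1 := ((abs_re_le_norm w').trans hn.le)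
  have hI : |w'.imI| ≤ 1 := by
    have h1 : |w'.imI| ≤ ‖w'.im‖ := abs_imI_le_norm_im w'
    have h2 : ‖w'.im‖ ≤ ‖w'‖ := by
      have := sq_norm_im_eq w'
      nlinarith [sq_nonneg w'.re, norm_nonneg w', norm_nonneg w'.im]
    exact h1.trans (h2.trans hn.le)
  have hc : ‖(star u * y * u) * w' - w' * (star u * y * u)‖ ≤ s := by
    rw [hw', comm_conj_of_norm_eq_one hu, norm_conj_of_norm_eq_one hu]
    exact hcomm
  have hsq : 4 * ‖y.im‖ ^ 2 * (w'.imJ ^ 2 + w'.imK ^ 2) ≤ s ^ 2 := by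
    rcases hstr with h | h
    · rw [← norm_comm_sq_axisPoint, ← h]
      exact pow_le_pow_left₀ (norm_nonneg _) hc 2
    · rw [← norm_comm_sq_star_axisPoint, ← h]
      exact pow_le_pow_left₀ (norm_nonneg _) hc 2
  have hb : (s / (2 * ‖y.im‖)) ^ 2 = s ^ 2 / (4 * ‖y.im‖ ^ 2) := by rw [div_pow]; ring
  have h4 : 0 < 4 * ‖y.im‖ ^ 2 := by positivity
  have hJ2 : w'.imJ ^ 2 ≤ (s / (2 * ‖y.im‖)) ^ 2 := by
    rw [hb, le_div_iff₀ h4]; nlinarith [sq_nonneg w'.imK]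
  have hK2 : w'.imK ^ 2 ≤ (s / (2 * ‖y.im‖)) ^ 2 := by
    rw [hb, le_div_iff₀ h4]; nlinarith [sq_nonneg w'.imJ]
  have hr0 : 0 ≤ s / (2 * ‖y.im‖) := by positivity
  have hJ := abs_le.1 (abs_le_of_sq_le_sq' hJ2 hr0 |> fun h => abs_le.2 h)
  have hK := abs_le.1 (abs_le_of_sq_le_sq' hK2 hr0 |> fun h => abs_le.2 h)
  obtain ⟨hre1, hre2⟩ := abs_le.1 hre
  obtain ⟨hI1, hI2⟩ := abs_le.1 hI
  exact ⟨hre1, hre2, hI1, hI2, hJ.1, hJ.2, hK.1, hK.2⟩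

/-- The commutator section is measurable. [folklore] -/
theorem measurableSet_comm_section (y : ℍ) (s : ℝ) : MeasurableSet {w : ℍ | ‖y * w - w * y‖ ≤ s} :=
  measurableSet_le (((continuous_const.mul continuous_id).sub (continuous_id.mul continuous_const)).norm).measurable measurable_const

/-- Volume of the commutator section inside the unit ball: `≤ 4s²/‖Im y‖²`. [folklore] -/
theorem volume_comm_section_le' {y : ℍ} {s : ℝ} (hs : 0 ≤ s) (hy : y.im ≠ 0) :
    volume ({w : ℍ | ‖y * w - w * y‖ ≤ s} ∩ Metric.ball 0 1) ≤ ENNReal.ofReal (4 * s ^ 2 / ‖y.im‖ ^ 2) := by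
  have hm : 0 < ‖y.im‖ := norm_pos_iff.2 hy
  obtain ⟨u, hu, hstr⟩ := exists_unit_straighten hy
  refine (measure_mono (comm_section_subset_preimage_box' hs hy hu hstr)).trans ?_
  rw [(conjIso u hu).measurePreserving.measure_preimage (measurableSet_quatBox _ _).nullMeasurableSet, volume_quatBox]
  · apply le_of_eq
    congr 1
    simp only [Matrix.cons_val_zero, Matrix.cons_val_one, Matrix.cons_val]
    field_simp
    ring
  · intro i
    have : 0 ≤ s / (2 * ‖y.im‖) := by positivity
    fin_cases i <;> simp <;> linarith

/-- ★ **Cone mass of the commutator section** (no argmax constraint): `cone{w : ‖yw − wy‖ ≤ s} ≤ coneConst·4s²/‖Im y‖²`. [folklore] -/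
theorem coneMeasure_comm_section_le' {y : ℍ} {s : ℝ} (hs : 0 ≤ s) (hy : y.im ≠ 0) :
    coneMeasure {w : ℍ | ‖y * w - w * y‖ ≤ s} ≤ ENNReal.ofReal (coneConst * (4 * s ^ 2 / ‖y.im‖ ^ 2)) := by
  rw [coneMeasure_eq _ (measurableSet_comm_section y s), ENNReal.ofReal_mul coneConst_pos.le, ← inv_volume_ball_eq]
  exact mul_le_mul_right (volume_comm_section_le' hs hy) _

/-! ## §4 The slab of almost traceless letters -/

/-- `{|re y| ≤ δ} ∩ B⁴ ⊆ [-δ, δ] × [-1,1]³`. [folklore] -/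
theorem reSlab_inter_ball_subset (δ : ℝ) :
    {y : ℍ | |y.re| ≤ δ} ∩ Metric.ball 0 1 ⊆ quatBox ![-δ, -1, -1, -1] ![δ, 1, 1, 1] := by
  intro y hy
  simp only [Set.mem_inter_iff, Set.mem_setOf_eq, Metric.mem_ball, dist_zero_right] at hy
  obtain ⟨hδ, hball⟩ := hy
  have hsq := sq_norm_eq_sum_sq y
  have hn := norm_nonneg y
  have hI : |y.imI| ≤ 1 := abs_le_of_sq_le_sq' (by nlinarith [sq_nonneg y.re, sq_nonneg y.imJ, sq_nonneg y.imK]) zero_le_one |> fun h => abs_le.2 h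
  have hJ : |y.imJ| ≤ 1 := abs_le_of_sq_le_sq' (by nlinarith [sq_nonneg y.re, sq_nonneg y.imI, sq_nonneg y.imK]) zero_le_one |> fun h => abs_le.2 h
  have hK : |y.imK| ≤ 1 := abs_le_of_sq_le_sq' (by nlinarith [sq_nonneg y.re, sq_nonneg y.imI, sq_nonneg y.imJ]) zero_le_one |> fun h => abs_le.2 h
  obtain ⟨h1, h2⟩ := abs_le.1 hδ
  obtain ⟨hI1, hI2⟩ := abs_le.1 hI
  obtain ⟨hJ1, hJ2⟩ := abs_le.1 hJ
  obtain ⟨hK1, hK2⟩ := abs_le.1 hK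
  simp only [quatBox, Set.mem_setOf_eq, Matrix.cons_val_zero, Matrix.cons_val_one, Matrix.cons_val]
  exact ⟨h1, h2, hI1, hI2, hJ1, hJ2, hK1, hK2⟩

/-- `{|re y| ≤ δ}` is measurable. [folklore] -/
theorem measurableSet_reSlab (δ : ℝ) : MeasurableSet {y : ℍ | |y.re| ≤ δ} :=
  measurableSet_le (continuous_re.abs).measurable measurable_const

/-- ★ `cone{|re y| ≤ δ} ≤ coneConst · 16δ` (`δ ≥ 0`). [folklore] -/
theorem coneMeasure_reSlab_le {δ : ℝ} (hδ : 0 ≤ δ) :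
    coneMeasure {y : ℍ | |y.re| ≤ δ} ≤ ENNReal.ofReal (coneConst * (16 * δ)) := by
  rw [coneMeasure_eq _ (measurableSet_reSlab δ), ENNReal.ofReal_mul coneConst_pos.le, ← inv_volume_ball_eq]
  refine mul_le_mul_right ((measure_mono (reSlab_inter_ball_subset δ)).trans ?_) _
  rw [volume_quatBox]
  · apply le_of_eq
    congr 1
    simp only [Matrix.cons_val_zero, Matrix.cons_val_one, Matrix.cons_val]
    ring
  · intro i
    fin_cases i <;> simp [hδ]

end Summit.QuantumFields.YangMills.Theorems.SwapVirialDeficit.AnticommutingSections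

end
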